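import Summits.Ventures.HodgeKum4.Theorems.KummerFixedLocusLefschetzGenerationKum4
import Literature.Computation.KummerOrbifold.SeedDegrees5
import Literature.AlgebraicTopology.SingularHomology.CupProductProofs
import HarnessLib

/-!
# Route KummerFixedLocus (`hodge-kum4`, rung H3) — MODEL_X forces graded commutativity of the
# certified generator columns on `C₀` (a necessary condition of item stmt-Ventures-19267, kernel)

Seat p1 (g3).  SUPPORT for the route item **MODEL_X** = `Summit.Ventures.HodgeKum4.KummerOrbifoldModelKum4`
(stmt-Ventures-19267; `@[conjecture]`, OURS/COMPUTED identification of the frame-invariant cohomology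
`H*(X(ℂ); ℂ)^{g}` of a `Kum⁴`-type `X` with the generated module `C₀ = modelSpace ℂ` of the certified
`m = 5` Kummer orbifold model, `Literature/Computation/KummerOrbifold`).  PROVED here (sorry-free):

* `totalCup_left_comm` — on the tree's total cohomology `H*(Y; R)`, for homogeneous `x ∈ Hᵖ`, `y ∈ Hᵠ`
  and any `v`: `x · (y · v) = (-1)^{pq} y · (x · v)` (from the tree theorems `cupProduct_assoc` and
  `cupProduct_gradedComm_holds`, Hatcher Thm. 3.11);
* `seedPreimage_degree_eq` — under the `h`-intertwining clause of `ModelCore`, a homogeneous preimage of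
  a non-zero seed `s` has degree `seedDeg s` (the seeds are `h`-eigenvectors: `degOp_seedVec`, module
  `Computation/KummerOrbifold/SeedDegrees5`, a 17-vector certificate);
* **`genOp_superComm_of_modelCore`** — if a cup-closed `Inv ⊆ H*(Y; ℂ)` satisfies `ModelCore Inv`, then
  for all generators `i, j < 16` and all `v ∈ C₀`:
  `genOp i (genOp j v) = (-1)^{seedDeg(i+1)·seedDeg(j+1)} • genOp j (genOp i v)`; in particular
  (`genOp_genOp_self_eq_zero_of_modelCore`) an odd generator squares to zero on `C₀`;
* **`genOp_superComm_of_kummerOrbifoldModelKum4`** — MODEL_X ⇒ the same for every smooth projective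
  `Kum⁴`-type `X` with a Kummer translation frame; and the refutation schema
  **`not_kummerOrbifoldModelKum4_of_superComm_violation`** — given ONE framed `Kum⁴`-type `X`, one
  vector of `C₀` and one generator pair violating graded commutativity would refute MODEL_X as stated.

Why this matters for the item's why-might-fail ("a basis-ordering or sign slip in the FG discrete-torsion
product (`colGen5`, `C₀`) … breaks φ's multiplicativity on a seed"): none of the landed certificates
(`certificate5`, `replay5`, `ClosureCertificate5{,ImagesI,ImagesIb,ImagesII}` — ranks, Molien count,
centralizer invariance, the `sl₂` identity) is sensitive to the ORDER of two generator multiplications,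
and the twisted degree-`3` generators `G₁₁ … G₁₄` do not occur in the 1566 closure words at all.  The
cell's computations of this necessary condition found NO violation: farm probe on the certified `colGen5`
tables (20 generator pairs incl. `δ`, `G₁₁ … G₁₄`, `ω₀` and the odd squares, on the 17 seeds + 40 words,
exact over `ℚ`) and the exhaustive check in the code-disjoint census model (kit job j269733: all `15 × 15`
generator pairs on a 1566-vector basis of the invariant ring, exact; plus Poincaré duality of every
degree) — EVIDENCE for the computed clause, recorded on the item; the identification half of MODEL_X stays
cited (FTV19 Thm 1.4/1.5, FG03 Thm 3.10, BNWS, HT13, Ehresmann) and the item stays `@[conjecture]`.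
Nothing here says MODEL_X, L1, `HC_Kum4Type` or the Hodge conjecture is proved.
-/

set_option autoImplicit false

namespace Summit.Ventures.HodgeKum4

open CategoryTheory
open Literature.AlgebraicGeometry Literature.AlgebraicGeometry.Hyperkaehler
open Literature.AlgebraicGeometry.HodgeTheory
open Literature.AlgebraicTopology.SingularHomology
open Literature.Computation.KummerOrbifold Literature.Computation.Sparse

universe u v

section TotalCup

variable {R : Type v} [CommRing R] {Y : Type u} [TopologicalSpace Y]

/-- `x ⌣ (y ⌣ z) = (-1)^{pq} · y ⌣ (x ⌣ z)` for homogeneous classes `x ∈ Hᵖ`, `y ∈ Hᵠ`, `z ∈ Hʳ`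
(associativity and graded commutativity of the cup product; both sides placed in one degree `s`). -/
theorem cupProduct_left_comm {p q r s : ℕ} (hx : p + (q + r) = s) (hy : q + (p + r) = s)
    (x : singularCohomology R R Y p) (y : singularCohomology R R Y q) (z : singularCohomology R R Y r) :
    cupProduct hx x (cupProduct rfl y z) = ((-1 : R) ^ (p * q)) • cupProduct hy y (cupProduct rfl x z) := by
  have hm : p + q + r = s := by omega
  rw [← cupProduct_assoc rfl rfl hm hx x y z,
    cupProduct_gradedComm_holds R Y (rfl : p + q = p + q) (Nat.add_comm q p) x y, map_smul,
    LinearMap.smul_apply, cupProduct_assoc (Nat.add_comm q p) rfl hm hy y x z]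

/-- Re-indexing a homogeneous summand of `H*(Y; R)` along equal degrees. -/
theorem ofDegree_cupProduct_eq {q n a b : ℕ} (ha : q + n = a) (hb : q + n = b)
    (y : singularCohomology R R Y q) (w : singularCohomology R R Y n) :
    ofDegree R Y a (cupProduct ha y w) = ofDegree R Y b (cupProduct hb y w) := by
  subst ha; subst hb; rfl

/-- **Graded commutativity on total cohomology, operator form**: for homogeneous `x ∈ Hᵖ`, `y ∈ Hᵠ`
and ANY `v ∈ H*(Y; R)`, `x · (y · v) = (-1)^{pq} y · (x · v)` (`·` = `totalCup`). -/
theorem totalCup_left_comm (p q : ℕ) (x : singularCohomology R R Y p) (y : singularCohomology R R Y q)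
    (v : totalCohomology R Y) :
    totalCup R Y (ofDegree R Y p x) (totalCup R Y (ofDegree R Y q y) v) =
      ((-1 : R) ^ (p * q)) • totalCup R Y (ofDegree R Y q y) (totalCup R Y (ofDegree R Y p x) v) := by
  induction v using DirectSum.induction_on with
  | zero => simp only [map_zero, smul_zero]
  | of r z =>
    rw [← DirectSum.lof_eq_of R]
    change totalCup R Y (ofDegree R Y p x) (totalCup R Y (ofDegree R Y q y) (ofDegree R Y r z)) =
      ((-1 : R) ^ (p * q)) •
        totalCup R Y (ofDegree R Y q y) (totalCup R Y (ofDegree R Y p x) (ofDegree R Y r z))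
    rw [totalCup_lof, totalCup_lof, totalCup_lof, totalCup_lof,
      cupProduct_left_comm (rfl : p + (q + r) = p + (q + r)) (by omega) x y z, map_smul,
      ofDegree_cupProduct_eq (by omega : q + (p + r) = p + (q + r)) rfl]
  | add u w hu hw => simp only [map_add, hu, hw, smul_add]

end TotalCup

section ModelCore

variable {Y : Type u} [TopologicalSpace Y]

/-- **Degree of a seed preimage.**  Under the `h`-intertwining clause of `ModelCore`, a homogeneous
class of degree `k` mapped by `φ` to a NON-ZERO seed `s` has `k = seedDeg s` (the seed is an
`h`-eigenvector with eigenvalue `seedDeg s - 8`: `degOp_seedVec`). -/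
theorem seedPreimage_degree_eq {Inv : Submodule ℂ (totalCohomology ℂ Y)} (φ : Inv →ₗ[ℂ] (ℕ →₀ ℂ))
    (hdeg : ∀ (y : totalCohomology ℂ Y) (hy : y ∈ Inv) (hhy : degreeOperator ℂ Y 8 y ∈ Inv),
      φ ⟨_, hhy⟩ = degOp ℂ (φ ⟨y, hy⟩))
    {k s : ℕ} {x : singularCohomology ℂ ℂ Y k} (hx : ofDegree ℂ Y k x ∈ Inv)
    (hφ : φ ⟨_, hx⟩ = seedVec ℂ s) (hs : seedVec ℂ s ≠ 0) : k = seedDeg s := by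
  have hh : degreeOperator ℂ Y 8 (ofDegree ℂ Y k x) ∈ Inv := by
    rw [degreeOperator_lof]; exact Inv.smul_mem _ hx
  have e := hdeg _ hx hh
  have lhs : φ ⟨_, hh⟩ = ((k : ℂ) - (8 : ℕ)) • seedVec ℂ s := by
    have : (⟨degreeOperator ℂ Y 8 (ofDegree ℂ Y k x), hh⟩ : Inv) = ((k : ℂ) - (8 : ℕ)) • (⟨_, hx⟩ : Inv) :=
      Subtype.ext (by simp only [degreeOperator_lof, SetLike.val_smul])
    rw [this, map_smul, hφ]
  rw [lhs, hφ, degOp_seedVec, ← sub_eq_zero, ← sub_smul, smul_eq_zero] at e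
  rcases e with e | e
  · push_cast at e
    have : (k : ℂ) = seedDeg s := by linear_combination e
    exact_mod_cast this
  · exact absurd e hs

/-- **`ModelCore` forces graded commutativity of the generator operators on `C₀`.**  If a cup-closed
submodule `Inv ⊆ H*(Y; ℂ)` satisfies `ModelCore Inv`, then for all generators `i, j < 16` and every
`v ∈ C₀ = modelSpace ℂ`: `G_i (G_j v) = (-1)^{d_i d_j} G_j (G_i v)`, `d = seedDeg (· + 1)` (the cup
product being associative and graded-commutative, and `φ` intertwining cup product by a seed preimage
with `genOp`).  The super-commutation of the certified columns `colGen5` on `C₀` is therefore a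
NECESSARY CONDITION of the route item MODEL_X, testable by computation. -/
theorem genOp_superComm_of_modelCore {Inv : Submodule ℂ (totalCohomology ℂ Y)} (hcup : IsCupClosed Inv)
    (hM : ModelCore Inv) {i j : ℕ} (hi : i < 16) (hj : j < 16) {v : ℕ →₀ ℂ} (hv : v ∈ modelSpace ℂ) :
    genOp ℂ i (genOp ℂ j v) =
      ((-1 : ℂ) ^ (seedDeg (i + 1) * seedDeg (j + 1))) • genOp ℂ j (genOp ℂ i v) := by
  obtain ⟨φ, x₀, hx₀, hinj, hrange, -, hdeg, hseeds, hmul⟩ := hM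
  obtain ⟨ki, -, xi, hxi, hφi⟩ := hseeds (i + 1)
  obtain ⟨kj, -, xj, hxj, hφj⟩ := hseeds (j + 1)
  rw [← hrange, LinearMap.mem_range] at hv
  obtain ⟨⟨y, hy⟩, rfl⟩ := hv
  have h1 : totalCup ℂ Y (ofDegree ℂ Y kj xj) y ∈ Inv := hcup _ hxj _ hy
  have h2 : totalCup ℂ Y (ofDegree ℂ Y ki xi) (totalCup ℂ Y (ofDegree ℂ Y kj xj) y) ∈ Inv :=
    hcup _ hxi _ h1
  have h3 : totalCup ℂ Y (ofDegree ℂ Y ki xi) y ∈ Inv := hcup _ hxi _ hy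
  have h4 : totalCup ℂ Y (ofDegree ℂ Y kj xj) (totalCup ℂ Y (ofDegree ℂ Y ki xi) y) ∈ Inv :=
    hcup _ hxj _ h3
  rw [← hmul j hj _ hxj hφj y hy h1, ← hmul i hi _ hxi hφi _ h1 h2, ← hmul i hi _ hxi hφi y hy h3,
    ← hmul j hj _ hxj hφj _ h3 h4]
  have hsub : (⟨_, h2⟩ : Inv) = ((-1 : ℂ) ^ (ki * kj)) • (⟨_, h4⟩ : Inv) :=
    Subtype.ext (by simp only [SetLike.val_smul]; exact totalCup_left_comm ki kj xi xj y)
  rw [hsub, map_smul]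
  by_cases hzi : seedVec ℂ (i + 1) = 0
  · have h0 : (⟨ofDegree ℂ Y ki xi, hxi⟩ : Inv) = 0 := hinj (by rw [hφi, hzi, map_zero])
    have hXi : ofDegree ℂ Y ki xi = 0 := by simpa using congrArg Subtype.val h0
    have : (⟨_, h4⟩ : Inv) = 0 := Subtype.ext (by simp only [hXi, map_zero, LinearMap.zero_apply,
      ZeroMemClass.coe_zero])
    rw [this, map_zero, smul_zero, smul_zero]
  by_cases hzj : seedVec ℂ (j + 1) = 0
  · have h0 : (⟨ofDegree ℂ Y kj xj, hxj⟩ : Inv) = 0 := hinj (by rw [hφj, hzj, map_zero])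
    have hXj : ofDegree ℂ Y kj xj = 0 := by simpa using congrArg Subtype.val h0
    have : (⟨_, h4⟩ : Inv) = 0 := Subtype.ext (by simp only [hXj, map_zero, LinearMap.zero_apply,
      ZeroMemClass.coe_zero])
    rw [this, map_zero, smul_zero, smul_zero]
  rw [← seedPreimage_degree_eq φ hdeg hxi hφi hzi, ← seedPreimage_degree_eq φ hdeg hxj hφj hzj]

/-- **Odd generators square to zero on `C₀`** under `ModelCore` (a generator whose seed has odd degree
anti-commutes with itself; characteristic `0`). -/
theorem genOp_genOp_self_eq_zero_of_modelCore {Inv : Submodule ℂ (totalCohomology ℂ Y)}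
    (hcup : IsCupClosed Inv) (hM : ModelCore Inv) {i : ℕ} (hi : i < 16) (hodd : Odd (seedDeg (i + 1)))
    {v : ℕ →₀ ℂ} (hv : v ∈ modelSpace ℂ) : genOp ℂ i (genOp ℂ i v) = 0 := by
  have h := genOp_superComm_of_modelCore hcup hM hi hi hv
  rw [(Odd.mul hodd hodd).neg_one_pow, neg_one_smul, eq_neg_iff_add_eq_zero, ← two_smul ℂ,
    smul_eq_zero] at h
  exact h.resolve_left two_ne_zero

end ModelCore

/-! ### The route item: MODEL_X ⇒ super-commutation on `C₀`; a violation would refute MODEL_X -/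

/-- **MODEL_X forces graded commutativity of the certified generator columns on `C₀`** — for every
smooth projective `X` of `Kum⁴`-type with a Kummer translation frame `g` (the frame invariants are
cup-closed, being the invariants of pull-backs, `invariantClasses_isCupClosed`). -/
theorem genOp_superComm_of_kummerOrbifoldModelKum4 (hM : KummerOrbifoldModelKum4)
    {X : Motives.SchemeOver ℂ} (g : (Fin 4 → ZMod 5) → (X ⟶ X)) (hX : Motives.IsSmoothProjective 8 X)
    (hK : IsOfGeneralizedKummerType 4 X) (hg : IsKummerTranslationFrame X g)
    {i j : ℕ} (hi : i < 16) (hj : j < 16) {v : ℕ →₀ ℂ} (hv : v ∈ modelSpace ℂ) :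
    genOp ℂ i (genOp ℂ j v) =
      ((-1 : ℂ) ^ (seedDeg (i + 1) * seedDeg (j + 1))) • genOp ℂ j (genOp ℂ i v) :=
  genOp_superComm_of_modelCore (invariantClasses_isCupClosed _) (hM g hX hK hg) hi hj hv

/-- **MODEL_X forces the odd generators to square to zero on `C₀`** (same setting). -/
theorem genOp_genOp_self_eq_zero_of_kummerOrbifoldModelKum4 (hM : KummerOrbifoldModelKum4)
    {X : Motives.SchemeOver ℂ} (g : (Fin 4 → ZMod 5) → (X ⟶ X)) (hX : Motives.IsSmoothProjective 8 X)
    (hK : IsOfGeneralizedKummerType 4 X) (hg : IsKummerTranslationFrame X g)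
    {i : ℕ} (hi : i < 16) (hodd : Odd (seedDeg (i + 1))) {v : ℕ →₀ ℂ} (hv : v ∈ modelSpace ℂ) :
    genOp ℂ i (genOp ℂ i v) = 0 :=
  genOp_genOp_self_eq_zero_of_modelCore (invariantClasses_isCupClosed _) (hM g hX hK hg) hi hodd hv

/-- **Refutation schema for MODEL_X**: if some smooth projective `Kum⁴`-type `X` with a Kummer
translation frame exists, ONE vector `v ∈ C₀` and ONE pair of generators violating graded
commutativity refute `KummerOrbifoldModelKum4` as stated.  (The cell's computations — farm probe on
the certified tables, kit job j269733 in the code-disjoint census model — found NO violation; this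
theorem records what a violation would have meant.) -/
theorem not_kummerOrbifoldModelKum4_of_superComm_violation
    (hex : ∃ (X : Motives.SchemeOver ℂ) (g : (Fin 4 → ZMod 5) → (X ⟶ X)),
      Motives.IsSmoothProjective 8 X ∧ IsOfGeneralizedKummerType 4 X ∧ IsKummerTranslationFrame X g)
    {i j : ℕ} (hi : i < 16) (hj : j < 16) {v : ℕ →₀ ℂ} (hv : v ∈ modelSpace ℂ)
    (hne : genOp ℂ i (genOp ℂ j v) ≠
      ((-1 : ℂ) ^ (seedDeg (i + 1) * seedDeg (j + 1))) • genOp ℂ j (genOp ℂ i v)) :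
    ¬ KummerOrbifoldModelKum4 := by
  rintro hM
  obtain ⟨X, g, hX, hK, hg⟩ := hex
  exact hne (genOp_superComm_of_kummerOrbifoldModelKum4 hM g hX hK hg hi hj hv)

end Summit.Ventures.HodgeKum4
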